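import Summits.QuantumFields.YangMills.Theorems.BalabanUVNodesN07HessOpOfRecordSymmetric
import Literature.MathematicalPhysics.QuantumFieldTheory.Balaban1983to89.B9Eq3119DeltaPiCarrier
import HarnessLib

/-!
# NODE N07 — W₇'s SYMMETRY BINDER `hΔ` OF lit `pair27_W80` FOR def-Y's LETTER `Δπ := DeltaPiCurOfRecord` (✓3f′ `Node00.BgRemainderOfRecord`, the `Δπ`-slot of
# `WOfRecordAt`), AT EVERY BACKGROUND, FOR ANY `G′`, `Q′`, HYPOTHESIS-FREE: `⟨Δπ Y, Z⟩₍₂₇₎ = ⟨Δπ Z, Y⟩₍₂₇₎` — [B9] (3.119) «⟨A, Δ_πA⟩» is a quadratic form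

Cell `pub-ymgap`, width seat `pub-ymgap-dag-n07-w3` (g25), INTENT-9 ∕ CLAIM-9.  `--kind proof --supports stmt-QuantumFields-27238 --as helper`; count-neutral.
[15] = [Balaban1985Variational]; [B9] = [Balaban1985BackgroundPropagators]; [B7] = [Balaban1985Averaging].

WHAT.  def-Y's 3f′ reads the W₇ letter of (80) as `DeltaPiCurOfRecord Gp Q′ := currentCLM φ (pairLevLit) (∇^{U₀}) (hessOpOfRecordPiT Gp Q′)` with the TRANSPOSE reading
`hessOpOfRecordPiT := deltaPi φ π Δ(U₀) = πᵗ Δ(U₀) π` (lit `B9Eq3119DeltaPiCarrier`), and lists the binder `hΔ` of lit ✓`B11Eq80Current.pair27_W80` — «`∀ Y Z, pair27 τ (Δπ Y)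
(flat115 Z) = pair27 τ (Δπ Z) (flat115 Y)`» — as the prover's.  lit proves every piece generically: ✓`tpair_hessOp_comm` (the Hessian (3.10) is symmetric for the
BILINEAR trace pairing at a unitary background with a tracial `τ` and the norming `⟨φ⁻¹X, φ⁻¹Y⟩ = τ(X⋆Y)`), ✓`tpair_deltaPi_comm` (`πᵗΔπ` inherits it, nothing asked of `π`),
✓`pairSum_currentCLM_comm` + ✓`pair27_eq_sum` (the (27)-pairing form).  The record's three letters are ✓p819846's `star_coe_unitsOfRecord`, `tauRec_mul_comm` and
def-Y's ✓`inner_phiRec_symm`.  Here: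
* §1 ★ `tpair_hessOpOfRecord_comm` (`Δ(U₀)` bilinear-symmetric, every `U₀`), `tpair_hessOpOfRecordPiT_comm` (`πᵗΔ(U₀)π`, any `G′`, `Q′`);
* §2 `currentCLMOfRecord_pairSum_comm_of_tpair_comm`, ★ `currentCLMOfRecord_pair27_comm_of_tpair_comm` — for ANY `L²` operator `T` bilinear-symmetric at the record, its
  current reading is (27)-symmetric (the shape def-Y's 3g′ token `Delta2SymmTok Δ2` unfolds to); `DeltaPiCurOfRecord_pairSum_comm`,
  ★★★ **`DeltaPiCurOfRecord_pair27_comm`** — W₇'s `hΔ` VERBATIM for `Δπ := DeltaPiCurOfRecord F N K k Ω U₀ Gp Q′`, every background, any `G′`, `Q′`, no hypothesis;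
* §3 `hessOpOfRecordPiT_gaugeMode`, ★ `DeltaPiCurOfRecord_gaugeMode` — `Δπ` sends the (115)-configuration of a gauge mode `D_{U₀}λ`, `Q′λ = 0`, to the zero current, given
  (g5) for `G′`; `DeltaPiCurOfRecord_greenK_gaugeMode` — (g5) discharged for print's `G′ := (T′)⁻¹` (✓`printGreen_gaugeMode_ofRecord`).

HONEST LABELS.  Bilinear-pairing bookkeeping over lit's constructed letters; NO estimate (`‖Δπ‖` of [B9] (3.132), locality (3.117), Thm 3.11∕3.12 untouched); the Sect. C
regime ∕ `Prop4Hyp` of `pair27_W80` stay displayed.  Count-neutral; N07 NOT discharged; P0 ⟨26900⟩ OPEN; R4 is the conditional finite-𝕋⁴ rung only.  Nothing here is a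
claim about the Yang–Mills mass gap (`Summit.QuantumFields`): finite torus, fixed `ε`; nothing continuum ∕ OS ∕ Clay.
-/

set_option autoImplicit false

noncomputable section

open scoped Matrix Matrix.Norms.L2Operator InnerProductSpace ComplexConjugate BigOperators

namespace Summit.QuantumFields.YangMills.Theorems.N07DeltaPiOfRecordPairing

open Literature.MathematicalPhysics.QuantumFieldTheory.Balaban1983to89
open Literature.MathematicalPhysics.QuantumFieldTheory.Balaban1983to89.T4Continuum (T4Family)
open T4Continuum BlockAveraging
open B9SectCLatticeCarrier (Bond)
open B9Eq311L2Pairing (WL2)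
open B9Eq311TracePairing (tpair)
open B11Eq111FrakG (nabla115)
open B11Eq103H1Complex (SiteL2K BondL2K covDerivL2K covLaplaceSiteK greenK funEquiv)
open B11Eq115Space (NegSup NegSize levWeight)
open B11Eq90V0primeCurrent (flat115)
open B11Eq90Transpose (pair27 pair27_eq_sum)
open B9Eq3119DeltaPiCarrier (deltaPi currentCLM tpair_deltaPi_comm deltaPi_apply_eq_zero pairSum_currentCLM_comm equiv_currentCLM)
open Node00
open Summit.QuantumFields.YangMills.Theorems.N07HessOpOfRecordSymmetric (star_coe_unitsOfRecord tauRec_mul_comm)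
open Summit.QuantumFields.YangMills.Theorems.N07PrintProjectionOfRecord (printGreen_gaugeMode_ofRecord)

variable (F : T4Family) (N : ℕ) {K : ℕ} (k : ℕ) (U₀ : GaugeField (F.P K) 0 (SU N)) {F' : Type*} [AddCommGroup F'] [Module ℂ F']

/-! ## §1  `Δ(U₀)` and `πᵗΔ(U₀)π` are symmetric for the BILINEAR trace pairing, at every background -/

/-- ★ **`Δ(U₀)` OF RECORD IS SYMMETRIC FOR THE BILINEAR TRACE PAIRING `(f, g) = Σ_b c₀ tr(f(b)g(b))` AT EVERY BACKGROUND** — the complex-bilinear companion of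
✓`hessOpOfRecord_isSymmetric` (lit ✓`tpair_hessOp_comm` with the record's unitary ∕ tracial ∕ norming letters). [cite: Balaban1985BackgroundPropagators, (3.10) p.392, (3.11) p.392] -/
theorem tpair_hessOpOfRecord_comm [Fact (0 < c0Rec F K k)]
    (x y : BondL2K ℂ (F.P K).d (fun _ => (F.P K).sitesPerDir 0) (c0Rec F K k) (WRec N)) :
    tpair (phiRec N) (tauRec N) x (hessOpOfRecord F N k U₀ y) = tpair (phiRec N) (tauRec N) y (hessOpOfRecord F N k U₀ x) :=
  B9Eq3119DeltaPiCarrier.tpair_hessOp_comm (phiRec N) (tauRec N) (tauRec_mul_comm N) inner_phiRec_symm ((F.P K).eta k)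
    (star_coe_unitsOfRecord F N U₀) x y

/-- **3f′'s TRANSPOSE READING `Δ_π(U₀) = πᵗ Δ(U₀) π` (`hessOpOfRecordPiT`) IS BILINEAR-SYMMETRIC**, for ANY `G′`, `Q′` (nothing asked of `π`; lit ✓`tpair_deltaPi_comm`).
[cite: Balaban1985BackgroundPropagators, (3.119) p.419, (3.10) p.392] -/
theorem tpair_hessOpOfRecordPiT_comm [Fact (0 < c0Rec F K k)]
    (Gp : SiteL2K ℂ (F.P K).d (fun _ => (F.P K).sitesPerDir 0) (c0Rec F K k) (WRec N) →ₗ[ℂ]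
      SiteL2K ℂ (F.P K).d (fun _ => (F.P K).sitesPerDir 0) (c0Rec F K k) (WRec N))
    (Q' : SiteL2K ℂ (F.P K).d (fun _ => (F.P K).sitesPerDir 0) (c0Rec F K k) (WRec N) →ₗ[ℂ] F')
    (A B : BondL2K ℂ (F.P K).d (fun _ => (F.P K).sitesPerDir 0) (c0Rec F K k) (WRec N)) :
    tpair (phiRec N) (tauRec N) A (hessOpOfRecordPiT F N k U₀ Gp Q' B) = tpair (phiRec N) (tauRec N) B (hessOpOfRecordPiT F N k U₀ Gp Q' A) :=
  tpair_deltaPi_comm (phiRec N) (tauRec N) (piOfRecord F N k U₀ Gp Q') (hessOpOfRecord F N k U₀) inner_phiRec_symm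
    (tpair_hessOpOfRecord_comm F N k U₀) A B

/-! ## §2  The (27)-pairing form: W₇'s binder `hΔ` for `DeltaPiCurOfRecord`, and for any bilinear-symmetric `L²` operator read as a current -/

section Carrier

variable [Fact (0 < (F.L : ℝ))] [Fact (0 < (F.P K).eta k)] [Fact (0 < c0Rec F K k)] (Ω : ℕ → Set (Site (F.P K) 0))

/-- **ANY `L²` OPERATOR `T` BILINEAR-SYMMETRIC AT THE RECORD, READ AS A CURRENT ON THE SPACE (115), IS SYMMETRIC IN THE `η^d Σ_b tr(·)` FORM** (lit ✓`pairSum_currentCLM_comm`,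
cyclic trace). [cite: Balaban1985Variational, (27) p.282, (80) p.290; Balaban1985BackgroundPropagators, (3.11) p.392] -/
theorem currentCLMOfRecord_pairSum_comm_of_tpair_comm
    {T : BondL2K ℂ (F.P K).d (fun _ => (F.P K).sitesPerDir 0) (c0Rec F K k) (WRec N) →ₗ[ℂ]
      BondL2K ℂ (F.P K).d (fun _ => (F.P K).sitesPerDir 0) (c0Rec F K k) (WRec N)}
    (hT : ∀ x y, tpair (phiRec N) (tauRec N) x (T y) = tpair (phiRec N) (tauRec N) y (T x)) (Y Z : Space115Lit F N K k Ω U₀) :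
    ((((F.P K).eta k : ℝ) : ℂ)) ^ (F.P K).d *
        ∑ b, tauRec N (NegSup.equiv (levWeight (F.L : ℝ) ((F.P K).eta k) (bondLevLit F Ω k) 3) (Matrix (Fin N) (Fin N) ℂ)
          (currentCLM (phiRec N) (pairLevLit F Ω k) (nabla115 ((F.P K).eta k) (unitsOfRecord F N U₀)) T Y) b * flat115 Z b) =
      ((((F.P K).eta k : ℝ) : ℂ)) ^ (F.P K).d *
        ∑ b, tauRec N (NegSup.equiv (levWeight (F.L : ℝ) ((F.P K).eta k) (bondLevLit F Ω k) 3) (Matrix (Fin N) (Fin N) ℂ)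
          (currentCLM (phiRec N) (pairLevLit F Ω k) (nabla115 ((F.P K).eta k) (unitsOfRecord F N U₀)) T Z) b * flat115 Y b) :=
  pairSum_currentCLM_comm (phiRec N) (tauRec N) (pairLevLit F Ω k) (nabla115 ((F.P K).eta k) (unitsOfRecord F N U₀)) (tauRec_mul_comm N) hT Y Z

/-- ★ **… AND IN THE (27)-PAIRING FORM `pair27 τ`** with def-Y's `τ := tauRecCLM` — the shape of W₇'s binder `hΔ` (and of 3g′'s token `Delta2SymmTok Δ2`, which is this statement at
`T := Δ2`). [cite: Balaban1985Variational, (27) p.282, (80) p.290] -/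
theorem currentCLMOfRecord_pair27_comm_of_tpair_comm
    {T : BondL2K ℂ (F.P K).d (fun _ => (F.P K).sitesPerDir 0) (c0Rec F K k) (WRec N) →ₗ[ℂ]
      BondL2K ℂ (F.P K).d (fun _ => (F.P K).sitesPerDir 0) (c0Rec F K k) (WRec N)}
    (hT : ∀ x y, tpair (phiRec N) (tauRec N) x (T y) = tpair (phiRec N) (tauRec N) y (T x)) (Y Z : Space115Lit F N K k Ω U₀) :
    pair27 (tauRecCLM N) (currentCLM (phiRec N) (pairLevLit F Ω k) (nabla115 ((F.P K).eta k) (unitsOfRecord F N U₀)) T Y) (flat115 Z) =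
      pair27 (tauRecCLM N) (currentCLM (phiRec N) (pairLevLit F Ω k) (nabla115 ((F.P K).eta k) (unitsOfRecord F N U₀)) T Z) (flat115 Y) := by
  rw [pair27_eq_sum, pair27_eq_sum]
  exact currentCLMOfRecord_pairSum_comm_of_tpair_comm F N k U₀ Ω hT Y Z

/-- **W₇'s `hΔ` for `DeltaPiCurOfRecord` in the `η^d Σ_b tr(·)` form.** [cite: Balaban1985Variational, (27) p.282, (80) p.290; Balaban1985BackgroundPropagators, (3.119) p.419] -/
theorem DeltaPiCurOfRecord_pairSum_comm
    (Gp : SiteL2K ℂ (F.P K).d (fun _ => (F.P K).sitesPerDir 0) (c0Rec F K k) (WRec N) →ₗ[ℂ]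
      SiteL2K ℂ (F.P K).d (fun _ => (F.P K).sitesPerDir 0) (c0Rec F K k) (WRec N))
    (Q' : SiteL2K ℂ (F.P K).d (fun _ => (F.P K).sitesPerDir 0) (c0Rec F K k) (WRec N) →ₗ[ℂ] F') (Y Z : Space115Lit F N K k Ω U₀) :
    ((((F.P K).eta k : ℝ) : ℂ)) ^ (F.P K).d *
        ∑ b, tauRec N (NegSup.equiv (levWeight (F.L : ℝ) ((F.P K).eta k) (bondLevLit F Ω k) 3) (Matrix (Fin N) (Fin N) ℂ)
          (DeltaPiCurOfRecord F N K k Ω U₀ Gp Q' Y) b * flat115 Z b) =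
      ((((F.P K).eta k : ℝ) : ℂ)) ^ (F.P K).d *
        ∑ b, tauRec N (NegSup.equiv (levWeight (F.L : ℝ) ((F.P K).eta k) (bondLevLit F Ω k) 3) (Matrix (Fin N) (Fin N) ℂ)
          (DeltaPiCurOfRecord F N K k Ω U₀ Gp Q' Z) b * flat115 Y b) :=
  currentCLMOfRecord_pairSum_comm_of_tpair_comm F N k U₀ Ω (tpair_hessOpOfRecordPiT_comm F N k U₀ Gp Q') Y Z

/-- ★★★ **W₇'s BINDER `hΔ` OF lit `pair27_W80`, VERBATIM, FOR def-Y's `Δπ := DeltaPiCurOfRecord F N K k Ω U₀ Gp Q′`** (the `Δπ`-slot of 3f′ `WOfRecordAt`): for all `Y Z`,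
`pair27 τ (Δπ Y) (flat115 Z) = pair27 τ (Δπ Z) (flat115 Y)` with `τ := tauRecCLM N` — at EVERY background, for ANY `G′`, `Q′`, NO hypothesis ([B9] (3.119) is a quadratic form;
unitary `SU(N)` background, cyclic trace, `⟨φ⁻¹X, φ⁻¹Y⟩ = tr X⋆Y`). [cite: Balaban1985Variational, (27) p.282, (80) p.290, (84)–(89) pp.290–291; Balaban1985BackgroundPropagators, (3.119) p.419, (3.10) p.392] -/
theorem DeltaPiCurOfRecord_pair27_comm
    (Gp : SiteL2K ℂ (F.P K).d (fun _ => (F.P K).sitesPerDir 0) (c0Rec F K k) (WRec N) →ₗ[ℂ]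
      SiteL2K ℂ (F.P K).d (fun _ => (F.P K).sitesPerDir 0) (c0Rec F K k) (WRec N))
    (Q' : SiteL2K ℂ (F.P K).d (fun _ => (F.P K).sitesPerDir 0) (c0Rec F K k) (WRec N) →ₗ[ℂ] F') (Y Z : Space115Lit F N K k Ω U₀) :
    pair27 (tauRecCLM N) (DeltaPiCurOfRecord F N K k Ω U₀ Gp Q' Y) (flat115 Z) =
      pair27 (tauRecCLM N) (DeltaPiCurOfRecord F N K k Ω U₀ Gp Q' Z) (flat115 Y) :=
  currentCLMOfRecord_pair27_comm_of_tpair_comm F N k U₀ Ω (tpair_hessOpOfRecordPiT_comm F N k U₀ Gp Q') Y Z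

/-! ## §3  `Δπ` kills the gauge modes -/

omit [Fact (0 < (F.L : ℝ))] [Fact (0 < (F.P K).eta k)] in
/-- **`πᵗΔ(U₀)π` KILLS WHAT `π` KILLS**: the gauge modes `D_{U₀}λ`, `Q′λ = 0`, given (g5) for `G′` (3f′ ✓`piOfRecord_gaugeMode`, lit ✓`deltaPi_apply_eq_zero`).
[cite: Balaban1985BackgroundPropagators, (3.119) p.419] -/
theorem hessOpOfRecordPiT_gaugeMode
    (Gp : SiteL2K ℂ (F.P K).d (fun _ => (F.P K).sitesPerDir 0) (c0Rec F K k) (WRec N) →ₗ[ℂ]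
      SiteL2K ℂ (F.P K).d (fun _ => (F.P K).sitesPerDir 0) (c0Rec F K k) (WRec N))
    (Q' : SiteL2K ℂ (F.P K).d (fun _ => (F.P K).sitesPerDir 0) (c0Rec F K k) (WRec N) →ₗ[ℂ] F')
    (g5 : ∀ l, Q' l = 0 → Gp (covLaplaceSiteK (cRec F K k) (RRec F N U₀) (SRec F N U₀) l) = l)
    {l : SiteL2K ℂ (F.P K).d (fun _ => (F.P K).sitesPerDir 0) (c0Rec F K k) (WRec N)} (hl : Q' l = 0) :
    hessOpOfRecordPiT F N k U₀ Gp Q' (covDerivL2K ℂ (c0Rec F K k) (cRec F K k) (RRec F N U₀) l) = 0 :=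
  deltaPi_apply_eq_zero (phiRec N) (piOfRecord F N k U₀ Gp Q') (hessOpOfRecord F N k U₀) (piOfRecord_gaugeMode F N k U₀ Gp Q' g5 hl)

/-- ★ **`Δπ` SENDS THE (115)-CONFIGURATION OF A GAUGE MODE TO THE ZERO CURRENT**: if `flat115 Y` is `D_{U₀}λ` read in `M_N(ℂ)` with `Q′λ = 0`, then `DeltaPiCurOfRecord … Gp Q′ Y = 0`,
given (g5) for `G′`. [cite: Balaban1985BackgroundPropagators, (3.119) p.419; Balaban1985Variational, (88)–(89) p.291] -/
theorem DeltaPiCurOfRecord_gaugeMode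
    (Gp : SiteL2K ℂ (F.P K).d (fun _ => (F.P K).sitesPerDir 0) (c0Rec F K k) (WRec N) →ₗ[ℂ]
      SiteL2K ℂ (F.P K).d (fun _ => (F.P K).sitesPerDir 0) (c0Rec F K k) (WRec N))
    (Q' : SiteL2K ℂ (F.P K).d (fun _ => (F.P K).sitesPerDir 0) (c0Rec F K k) (WRec N) →ₗ[ℂ] F')
    (g5 : ∀ l, Q' l = 0 → Gp (covLaplaceSiteK (cRec F K k) (RRec F N U₀) (SRec F N U₀) l) = l)
    {l : SiteL2K ℂ (F.P K).d (fun _ => (F.P K).sitesPerDir 0) (c0Rec F K k) (WRec N)} (hl : Q' l = 0) (Y : Space115Lit F N K k Ω U₀)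
    (hY : flat115 Y = funEquiv (phiRec N) (fun _ : Bond (F.P K).d (fun _ => (F.P K).sitesPerDir 0) => c0Rec F K k)
      (covDerivL2K ℂ (c0Rec F K k) (cRec F K k) (RRec F N U₀) l)) :
    DeltaPiCurOfRecord F N K k Ω U₀ Gp Q' Y = 0 := by
  apply (NegSup.equiv (levWeight (F.L : ℝ) ((F.P K).eta k) (bondLevLit F Ω k) 3) (Matrix (Fin N) (Fin N) ℂ)).injective
  funext b
  rw [DeltaPiCurOfRecord, equiv_currentCLM, hY, LinearEquiv.symm_apply_apply, hessOpOfRecordPiT_gaugeMode F N k U₀ Gp Q' g5 hl, WL2.equiv_zero,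
    Pi.zero_apply, map_zero]
  rfl

/-- **(g5) DISCHARGED FOR PRINT'S `G′ := (T′)⁻¹`** (`T′` positive, `= Δ_{U₀}` on `N(Q′♭)`): `Δπ` with `Gp := greenK T′` kills the gauge-mode configurations with no letter left.
[cite: Balaban1985BackgroundPropagators, (3.24)–(3.25) p.394, (3.119) p.419] -/
theorem DeltaPiCurOfRecord_greenK_gaugeMode
    (T' : SiteL2K ℂ (F.P K).d (fun _ => (F.P K).sitesPerDir 0) (c0Rec F K k) (WRec N) →ₗ[ℂ]
      SiteL2K ℂ (F.P K).d (fun _ => (F.P K).sitesPerDir 0) (c0Rec F K k) (WRec N))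
    (hpos' : ∀ x, x ≠ 0 → 0 < RCLike.re ⟪x, T' x⟫_ℂ)
    (hT' : ∀ l, QflatOfRecord F N k l = 0 → T' l = covLaplaceSiteK (cRec F K k) (RRec F N U₀) (SRec F N U₀) l)
    {l : SiteL2K ℂ (F.P K).d (fun _ => (F.P K).sitesPerDir 0) (c0Rec F K k) (WRec N)} (hl : QflatOfRecord F N k l = 0)
    (Y : Space115Lit F N K k Ω U₀)
    (hY : flat115 Y = funEquiv (phiRec N) (fun _ : Bond (F.P K).d (fun _ => (F.P K).sitesPerDir 0) => c0Rec F K k)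
      (covDerivL2K ℂ (c0Rec F K k) (cRec F K k) (RRec F N U₀) l)) :
    DeltaPiCurOfRecord F N K k Ω U₀ (greenK T' hpos') (QflatOfRecord F N k) Y = 0 :=
  DeltaPiCurOfRecord_gaugeMode F N k U₀ Ω (greenK T' hpos') (QflatOfRecord F N k) (fun _ hl' => printGreen_gaugeMode_ofRecord F N k U₀ T' hpos' hT' hl')
    hl Y hY

end Carrier

end Summit.QuantumFields.YangMills.Theorems.N07DeltaPiOfRecordPairing
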